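import Mathlib

/-!
# Triage sharpen for card `kernel-descent` (crux stmt-QuantumAdvantage-13931), triager r1-k2

The card's `QuarterSignRule` ("sgn Φ = sgn Σ_{|Φ_q| ≥ 3/5} Φ_q") is correct but, used as the descent step,
asks for the signs of up to FOUR quarter instances per level; over `n/2` levels of descent that is a
`4^{n/2}`-leaf recursion in the worst case.  The following ARGMAX rule needs ONE recursive call per level:
in a YES instance the quarter of (approximately) largest `|Φ_q|` is positive and itself `≥ 3/5 − 2ε`
(so it is a YES instance of the threshold-`(3/5 − 2ε)` problem on `n − 2` bits); symmetrically for NO.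
With `ε = 1/poly` from the landed `Φ²`-estimator this makes kernel descent a genuine polynomial-time
self-reduction (total threshold erosion `≤ n·ε`).
-/

open Finset

/-- ARGMAX QUARTER RULE. Four reals in `[-1,1]` with average `≥ 3/5`; `p` a quarter whose modulus is
within `2ε` of the maximal modulus (`ε < 1/15`). Then `Φ p > 0` and `|Φ p| ≥ 3/5 − 2ε`. -/
theorem maxQuarter_rule (Φ : Bool → Bool → ℝ) (ε : ℝ) (hε : ε < 1 / 15)
    (hb : ∀ q₀ q₁, |Φ q₀ q₁| ≤ 1)
    (havg : (3 / 5 : ℝ) ≤ (1 / 4) * ∑ q₀, ∑ q₁, Φ q₀ q₁) (p₀ p₁ : Bool)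
    (hmax : ∀ q₀ q₁, |Φ q₀ q₁| ≤ |Φ p₀ p₁| + 2 * ε) :
    0 < Φ p₀ p₁ ∧ 3 / 5 - 2 * ε ≤ |Φ p₀ p₁| := by
  simp only [Fintype.sum_bool] at havg
  have l1 := le_abs_self (Φ true true)
  have l2 := le_abs_self (Φ true false)
  have l3 := le_abs_self (Φ false true)
  have l4 := le_abs_self (Φ false false)
  have m1 := hmax true true
  have m2 := hmax true false
  have m3 := hmax false true
  have m4 := hmax false false
  have bp := hb p₀ p₁
  constructor
  · by_contra h
    have h' : Φ p₀ p₁ ≤ 0 := not_lt.mp h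
    have habs : |Φ p₀ p₁| = -Φ p₀ p₁ := abs_of_nonpos h'
    rcases p₀ with _ | _ <;> rcases p₁ with _ | _ <;> linarith
  · by_contra h
    have h' : |Φ p₀ p₁| < 3 / 5 - 2 * ε := not_le.mp h
    linarith

/-- The symmetric NO-side statement (apply the rule to `-Φ`). -/
theorem maxQuarter_rule_neg (Φ : Bool → Bool → ℝ) (ε : ℝ) (hε : ε < 1 / 15)
    (hb : ∀ q₀ q₁, |Φ q₀ q₁| ≤ 1)
    (havg : (1 / 4) * ∑ q₀, ∑ q₁, Φ q₀ q₁ ≤ -(3 / 5 : ℝ)) (p₀ p₁ : Bool)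
    (hmax : ∀ q₀ q₁, |Φ q₀ q₁| ≤ |Φ p₀ p₁| + 2 * ε) :
    Φ p₀ p₁ < 0 ∧ 3 / 5 - 2 * ε ≤ |Φ p₀ p₁| := by
  have key := maxQuarter_rule (fun q₀ q₁ => -Φ q₀ q₁) ε hε (by simpa using hb)
    (by
      simp only [Fintype.sum_bool] at havg ⊢
      linarith) p₀ p₁ (by simpa using hmax)
  simp only [abs_neg, Left.neg_pos_iff] at key
  exact key

/-- A YES instance CAN have a quarter deep in the NO promise: `(1, 1, 1, -3/5)` averages to `3/5`.
So "recurse on any big quarter" is wrong and "recurse on all big quarters" branches; argmax does neither. -/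
example : (1 / 4 : ℝ) * (1 + 1 + 1 + (-(3 / 5))) = 3 / 5 := by norm_num
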